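import Mathlib
import Summits.ValiantsHypothesis.ValiantsHypothesis.Theorems.NewtonUnitEquationsNewtonTauWeakK3R15Laurent

/-!
# `NewtonTauWeak` (stmt-ValiantsHypothesis-5904), sub-stub `fixedKCoincidence_t2_K3` (siege k15):
# counting tools — on-ray initial points of a fixed Laurent polynomial, ranges, finite unions

File of the siege line `K3R15` (towards the registered sub-stub `fixedKCoincidence_t2_K3` of
`stub_binomialNewtonTauCommon`, KPTT arXiv:1308.2286 Conj. 1 at `t = 2`, `K = 3`, no short 2-vs-1 relations).

* `onRay_inits_ncard_le` — for a FIXED `X ∈ ℂ[ℤ²]` and directions `E : Fin s → ℤ²`, the lattice points on the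
  rays `ℕ_{≥1} E_e` that are the `w`-initial support point of `X` for SOME weight `w` positive on all directions
  number at most `s`: on one ray the nearer point is lighter for every such weight (the "one vertex per ray per
  cell" count of `Cruxes/NewtonTauWeak/Lines/binomial-normal-form-ltc.md` §4);
* `ncard_range_le` — a range over a finite type has at most `card` elements;
* `ncard_iUnion_le` — a union over a finite type of sets of size `≤ B` has size `≤ card · B`.

No definitions. [folklore]
-/

-- the namespace mandated for this Theorems file repeats the component `ValiantsHypothesis`
set_option linter.dupNamespace false

noncomputable section

open scoped BigOperators Polynomial
open AddMonoidAlgebra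
open Summit.ValiantsHypothesis.ValiantsHypothesis.Theorems.NewtonTauWeakCorner

namespace Summit.ValiantsHypothesis.ValiantsHypothesis.Theorems.NewtonTauWeakK3R15

/-- **At most one initial point per ray.** [folklore] -/
theorem onRay_inits_ncard_le {s : ℕ} (E : Fin s → Fin 2 → ℤ) (X : AddMonoidAlgebra ℂ (Fin 2 → ℤ)) :
    {y : Fin 2 → ℤ | OnRay E y ∧ ∃ w : Fin 2 → ℝ, (∀ e, 0 < wt w (E e)) ∧ X.coeff y ≠ 0 ∧
      ∀ y', wt w y' < wt w y → X.coeff y' = 0}.ncard ≤ s := by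
  classical
  set OR := {y : Fin 2 → ℤ | OnRay E y ∧ ∃ w : Fin 2 → ℝ, (∀ e, 0 < wt w (E e)) ∧ X.coeff y ≠ 0 ∧
      ∀ y', wt w y' < wt w y → X.coeff y' = 0} with hOR
  -- the ray index of a point (junk value `s` off the rays)
  let f : (Fin 2 → ℤ) → ℕ := fun y => if h : OnRay E y then (Classical.choose h : Fin s) else s
  have hf_spec : ∀ y (h : OnRay E y), ∃ k : ℕ, 1 ≤ k ∧ y = (k : ℤ) • E (Classical.choose h) :=
    fun y h => Classical.choose_spec h
  have hmaps : ∀ y ∈ OR, f y ∈ ((Finset.range s : Finset ℕ) : Set ℕ) := by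
    intro y hy
    have h : OnRay E y := hy.1
    simp only [f, dif_pos h, Finset.coe_range, Set.mem_Iio]
    exact (Classical.choose h).isLt
  have hinj : Set.InjOn f OR := by
    intro y hy y' hy' hff
    have h : OnRay E y := hy.1
    have h' : OnRay E y' := hy'.1
    simp only [f, dif_pos h, dif_pos h'] at hff
    have hee : Classical.choose h = Classical.choose h' := Fin.ext hff
    obtain ⟨k, hk, hyk⟩ := hf_spec y h
    obtain ⟨k', hk', hyk'⟩ := hf_spec y' h'
    rw [← hee] at hyk'
    set e := Classical.choose h
    -- compare the multiplicities using the weight that makes the farther point initial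
    obtain ⟨w, hw, hX, hmin⟩ := hy.2
    obtain ⟨w', hw', hX', hmin'⟩ := hy'.2
    rcases lt_trichotomy k k' with hlt | heq | hgt
    · exfalso
      apply hX
      apply hmin'
      rw [hyk, hyk', wt_natsmul', wt_natsmul']
      exact mul_lt_mul_of_pos_right (by exact_mod_cast hlt) (hw' e)
    · rw [hyk, hyk', heq]
    · exfalso
      apply hX'
      apply hmin
      rw [hyk, hyk', wt_natsmul', wt_natsmul']
      exact mul_lt_mul_of_pos_right (by exact_mod_cast hgt) (hw e)
  calc OR.ncard ≤ (((Finset.range s : Finset ℕ) : Set ℕ)).ncard :=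
        Set.ncard_le_ncard_of_injOn f hmaps hinj (Finset.finite_toSet _)
    _ = s := by rw [Set.ncard_coe_finset, Finset.card_range]

/-- A range over a finite type has at most `card` elements. [folklore] -/
theorem ncard_range_le {ι α : Type*} [Fintype ι] (g : ι → α) : (Set.range g).ncard ≤ Fintype.card ι := by
  classical
  have : Set.range g = ((Finset.univ.image g : Finset α) : Set α) := by
    ext x; simp
  rw [this, Set.ncard_coe_finset]
  exact Finset.card_image_le.trans (by simp)

/-- A union over a finite type of sets of size `≤ B` has size `≤ card · B`. [folklore] -/
theorem ncard_iUnion_le {ι α : Type*} [Fintype ι] (A : ι → Set α) (B : ℕ)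
    (hA : ∀ i, (A i).ncard ≤ B) : (⋃ i, A i).ncard ≤ Fintype.card ι * B := by
  classical
  have key : ∀ T : Finset ι, (⋃ i ∈ T, A i).ncard ≤ T.card * B := by
    intro T
    induction T using Finset.induction_on with
    | empty => simp
    | insert i T hi ih =>
      rw [Finset.set_biUnion_insert, Finset.card_insert_of_notMem hi]
      calc (A i ∪ ⋃ x ∈ T, A x).ncard ≤ (A i).ncard + (⋃ x ∈ T, A x).ncard := Set.ncard_union_le _ _
        _ ≤ B + T.card * B := Nat.add_le_add (hA i) ih
        _ = (T.card + 1) * B := by ring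
  have huniv : (⋃ i, A i) = ⋃ i ∈ (Finset.univ : Finset ι), A i := by simp
  rw [huniv]
  exact (key Finset.univ).trans (by simp)

end Summit.ValiantsHypothesis.ValiantsHypothesis.Theorems.NewtonTauWeakK3R15

end
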